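import Literature.IUT.HodgeArakelov.ThetaEnvDataRecordBridge
import Literature.IUT.HodgeArakelov.TemperedThetaMonoidsSubdagProofs
import Literature.IUT.HodgeArakelov.MonoThetaProjectiveThetaEnv
import Literature.IUT.HodgeArakelov.CohomologyLimitKummer
import Literature.IUT.HodgeArakelov.EtaleThetaDataOfSettingConjStable

/-!
# Bridge B8, part 5e: [IUTchII] Prop. 3.1 (i) for the GENUINE `θ_env` data — the conjugation action of `Π^tp_{X̲̲}`
# permutes `{θ^ι_env(𝕄_*)}_ι`, `{∞θ^ι_env(𝕄_*)}_ι` (sub-DAG row J2 at the natural system of `X̲̲_K`)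

abc-iut cell, MERGE-MAP §8 **B8** (layer L6 ↔ L2), seat abc-iut-w4-d030 (gen 2); sub-DAG
`plan/L6/SUBDAG-IUTchII-Prop-31-33-34.md` (W6-S6, holder abc-iut-w5-d169), junction **J1** (abc-iut-w4-d019's
`ThetaEnvDataRecordBridge.lean`, p417552: the producer → record DATA BRIDGE `ThetaEnvData.toRecord act κ iota` and
`ThetaEnvData.thetaEnvPermuted_toRecord` = J2 from four hypotheses `hcompat`, `hθ`, `hinf`, `hι`). S. Mochizuki,
*Inter-universal Teichmüller theory II*, kurims manuscript (Dec. 2020), Prop. 3.1 (i) p. 87 l. 47–53: "one obtains a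
functorial algorithm `M^Θ_* ↦ {M^×_TM(M^Θ_*), θ^ι_env(M^Θ_*), ∞θ^ι_env(M^Θ_*), …}_ι` … where `ι` ranges over the inversion
automorphisms of Proposition 2.2, (i) … equipped with a natural conjugation action by `Π_X(M^Θ_*)`"
[claim: Mochizuki2012, status: disputed] (IUTchII §3 Prop 3.1 (i), kurims p.87).

HERE the bridge is INSTANTIATED at the genuine `θ_env` data of the natural projective system of model mono-theta
environments of `X̲̲_K` — part 5d's `EtaleLevels.thetaEnvData` (p415224; `cohEnv :=` the REAL continuous cohomology
system `coh C` of the [IUTchII] Prop. 1.4 output at `Π^tp_{X̲̲}`, coefficients identified through the limit rigidity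
isomorphism, identity transport; `hlim` discharged by part 5d′ `bijective_rigidLimHom`, p416249) — with the REAL
conjugation action of `Π_X(𝕄_*) = Π^tp_{X̲̲}` on `lim_J H¹(Π_Ÿ(𝕄_*)|_J, ·)`: abc-iut-w4-d043's `h1LimConjEquiv`
(`CohomologyLimitConj`, p412842 lineage) in abc-iut-w4-d007's multiplicative form `h1LimConjMulAut` (`CohomologyLimitKummer`).
Three of the four hypotheses of J2 are then THEOREMS:
* `hcompat` — the cyclotomic-rigidity transport is the identity on the carrier (part 5d), so `act` and `actD` agree: `rfl`;
* `hθ`, `hinf` — `toLim ⊤ '' θ(Π)` and `∞θ(Π)` of the Prop. 1.4 output are stable under conjugation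
  (`EtaleThetaDataOfSettingConjStable`: the one-root orbit `η̈^{Θ,l·ℤ×μ_2}` IS a `Π^tp_{X̲̲}`-conjugacy orbit);
and the fourth stays BY NAME: `hι` — "conjugates of inversion automorphisms are inversion automorphisms" (Prop. 2.2 (i)
p. 66) for the chosen family `iota` of inversion actions on the limit (at the model: the automorphism-PAIR transports
`h1LimAut` of abc-iut-L6-t1's `CohomologyAutFunctoriality`, intertwined with conjugation by `autMap_conj`; owners
abc-iut-w4-d010 / w5-d072). RESULT: `EtaleLevels.thetaEnvPermuted_record` — abc-iut-w5-d169's J2 predicate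
`TemperedThetaMonoids.ThetaEnvData.ThetaEnvPermuted` for the record PRODUCED from the genuine data, for EVERY Kummer
map `κ` of the constants (J4's datum, abc-iut-w4-d007's `h1LimKummerConstants` at the MLF model) and every
conjugation-closed inversion family; whence (`conj_permutes_both_record`) abc-iut-L6-d3/w5-d169's conclusion that the
conjugation action permutes BOTH families of theta monoids `{Ψ^ι_env}_ι`, `{∞Ψ^ι_env}_ι` once `M^×_TM` is stable
(`hU`; for `κ` `Π`-equivariant with stable image this is abc-iut-L6-t2's `constants_stable_of_equivariant_mrange` class).
PROOF-ONLY (no definitions). HONEST FRAMING: constructions over the cell's own model objects; nothing disputed is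
asserted; no side taken on [IUTchIII] Cor. 3.12; typed ≠ discharged.
-/

noncomputable section

namespace Literature.IUT.HodgeArakelov

open Literature.AnabelianGeometry.EtaleTheta Literature.AnabelianGeometry.SemiGraphs
open CohomologySystemOfContH1 EtaleThetaDataOfSetting
open scoped Literature.AnabelianGeometry.EtaleTheta

namespace EtaleLevels

variable {p : ℕ} [Fact p.Prime] {D : Literature.AnabelianGeometry.EtaleTheta.ThetaSetting p}
  {E : D.EtaleThetaData} {l : ℕ} (C : E.DoubleUnderline l) (hC : D.Compat) (hS : D.Sec2Hyps)
  (hl : l.Prime) (hp2 : p ≠ 2) (hpl : p ≠ l) (hζ : ∃ ζ : D.K, IsPrimitiveRoot ζ (4 * l))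
  (mods : ∀ M : ℕ+, D.CyclotomeMod l M)
  (f : contCocycles D.toTheta D.DeltaTheta C.GtpYdduu) (hf : f ∈ C.rootCocycles hC)
  (hmods : ∀ (M M' : ℕ+) (h : (M : ℕ) ∣ (M' : ℕ)) (x : D.lDeltaTheta l),
    MuN.red p M M' h ((mods M').red x) = (mods M).red x)
  (h15 : Literature.AnabelianGeometry.EtaleTheta.ThetaSetting.Prop15iii E hC) (L : C.CuspLabels)
  (hZ : ∀ M : ℕ+, Nonempty (ModelCyclotomes.lDeltaQuot (C.rigidData (mods M) hC hS h15 L) ≃*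
    Literature.IUT.HodgeTheaters.ZHat))
  (hcharY : EtaleThetaDataOfSetting.PiYddCharacteristic C)
  (hlim : Function.Bijective (rigidLimHom C hC hS hl hp2 hpl hζ mods f hf hmods h15 L hZ))
  [(EtaleThetaDataOfSetting.PiYdd C).Normal]

/-- **J2 `hcompat` at the genuine data is definitional**: the env-side action `h1LimConjMulAut σ` and the
`(l·Δ_Θ)`-side action `h1LimConjEquiv σ` agree through the (identity) cyclotomic-rigidity transport of part 5d.
[claim: Mochizuki2012, status: disputed] (IUTchII §3 Prop 3.1 (i), kurims p.87) -/
theorem conj_transportLim_compat (g : Pi C)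
    (x : (thetaEnvData C hC hS hl hp2 hpl hζ mods f hf hmods h15 L hZ hcharY hlim).D.coh.lim) :
    h1LimConjMulAut (phi C) (D.lDeltaTheta l) (PiYdd C) g
        (Multiplicative.ofAdd
          ((thetaEnvData C hC hS hl hp2 hpl hζ mods f hf hmods h15 L hZ hcharY hlim).transportLim x)) =
      Multiplicative.ofAdd
        ((thetaEnvData C hC hS hl hp2 hpl hζ mods f hf hmods h15 L hZ hcharY hlim).transportLim
          (h1LimConjEquiv (phi C) (D.lDeltaTheta l) (PiYdd C) g x)) :=
  rfl

/-- **J2 `hθ` at the genuine data**: every `g ∈ Π^tp_{X̲̲}` stabilises `toLim ⊤ '' θ(Π)` of the Prop. 1.4 output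
(`EtaleThetaDataOfSetting.image_h1LimConjEquiv_toLim_theta`). [claim: Mochizuki2012, status: disputed] (IUTchII §1 Prop 1.4, kurims p.27) -/
theorem image_conj_toLim_theta (g : Pi C) :
    h1LimConjEquiv (phi C) (D.lDeltaTheta l) (PiYdd C) g ''
        ((thetaEnvData C hC hS hl hp2 hpl hζ mods f hf hmods h15 L hZ hcharY hlim).D.coh.toLim ⊤ ''
          (thetaEnvData C hC hS hl hp2 hpl hζ mods f hf hmods h15 L hZ hcharY hlim).D.theta) =
      (thetaEnvData C hC hS hl hp2 hpl hζ mods f hf hmods h15 L hZ hcharY hlim).D.coh.toLim ⊤ ''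
        (thetaEnvData C hC hS hl hp2 hpl hζ mods f hf hmods h15 L hZ hcharY hlim).D.theta :=
  image_h1LimConjEquiv_toLim_theta C hC hS hcharY (setting C hC hS hl hp2 hpl hζ mods f hf)
    (ContinuousMulEquiv.refl _) rfl g

/-- **J2 `hinf` at the genuine data**: every `g ∈ Π^tp_{X̲̲}` stabilises `∞θ(Π)` of the Prop. 1.4 output
(`EtaleThetaDataOfSetting.image_h1LimConjEquiv_thetaInfty`). [claim: Mochizuki2012, status: disputed] (IUTchII §1 Prop 1.4, kurims p.27) -/
theorem image_conj_thetaInfty (g : Pi C) :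
    h1LimConjEquiv (phi C) (D.lDeltaTheta l) (PiYdd C) g ''
        (thetaEnvData C hC hS hl hp2 hpl hζ mods f hf hmods h15 L hZ hcharY hlim).D.thetaInfty =
      (thetaEnvData C hC hS hl hp2 hpl hζ mods f hf hmods h15 L hZ hcharY hlim).D.thetaInfty :=
  image_h1LimConjEquiv_thetaInfty C hC hS hcharY (setting C hC hS hl hp2 hpl hζ mods f hf)
    (ContinuousMulEquiv.refl _) rfl g

/-- **J2 — [IUTchII] Prop. 3.1 (i) for the genuine `θ_env` data**: for the Prop. 3.1 input record PRODUCED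
(abc-iut-w4-d019's `ThetaEnvData.toRecord`) from the natural system's `θ_env` data with the REAL conjugation action
`h1LimConjMulAut` of `Π^tp_{X̲̲}` on `lim_J H¹(Π_Ÿ(𝕄_*)|_J, Π_μ(𝕄_*))`, ANY Kummer map `κ` of the constants and ANY family
`iota` of inversion actions on the limit closed under conjugation in the sense `hι` ("conjugates of inversion
automorphisms are inversion automorphisms", Prop. 2.2 (i); BY NAME), the conjugation action PERMUTES
`{θ^ι_env(𝕄_*)}_ι` and `{∞θ^ι_env(𝕄_*)}_ι` — abc-iut-w5-d169's predicate `ThetaEnvPermuted`. The hypotheses `hcompat`,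
`hθ`, `hinf` of the bridge are DISCHARGED here. [claim: Mochizuki2012, status: disputed] (IUTchII §3 Prop 3.1 (i), kurims p.87) -/
theorem thetaEnvPermuted_record {M : Type} [CommMonoid M]
    (κ : M →* Multiplicative (thetaEnvData C hC hS hl hp2 hpl hζ mods f hf hmods h15 L hZ hcharY hlim).cohEnv.lim)
    {Iota : Type}
    (iota : Iota → ((thetaEnvData C hC hS hl hp2 hpl hζ mods f hf hmods h15 L hZ hcharY hlim).D.coh.lim ≃+
      (thetaEnvData C hC hS hl hp2 hpl hζ mods f hf hmods h15 L hZ hcharY hlim).D.coh.lim))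
    (hι : ∀ (g : Pi C) (ι : Iota), ∃ ι' : Iota, ∀ x,
      iota ι' (h1LimConjEquiv (phi C) (D.lDeltaTheta l) (PiYdd C) g x) =
        h1LimConjEquiv (phi C) (D.lDeltaTheta l) (PiYdd C) g (iota ι x)) :
    ((thetaEnvData C hC hS hl hp2 hpl hζ mods f hf hmods h15 L hZ hcharY hlim).toRecord
      (h1LimConjMulAut (phi C) (D.lDeltaTheta l) (PiYdd C)) κ iota).ThetaEnvPermuted :=
  ThetaEnvData.thetaEnvPermuted_toRecord _
    (actD := fun g => h1LimConjEquiv (phi C) (D.lDeltaTheta l) (PiYdd C) g)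
    (fun g x => conj_transportLim_compat C hC hS hl hp2 hpl hζ mods f hf hmods h15 L hZ hcharY hlim g x)
    (fun g => image_conj_toLim_theta C hC hS hl hp2 hpl hζ mods f hf hmods h15 L hZ hcharY hlim g)
    (fun g => image_conj_thetaInfty C hC hS hl hp2 hpl hζ mods f hf hmods h15 L hZ hcharY hlim g)
    hι

/-- **Corollary (abc-iut-L6-d3/w5-d169's `conj_permutes_both_of_thetaEnvPermuted` at the genuine data)**: once the
units `M^×_TM` of the record are stable under the action (`hU`; e.g. `κ` `Π`-equivariant with stable image), the
conjugation action permutes BOTH families of theta monoids `{Ψ^ι_env(𝕄_*)}_ι`, `{∞Ψ^ι_env(𝕄_*)}_ι` with the same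
re-indexing `ι ↦ ι'` (Prop. 3.1 (i): "equipped with a natural conjugation action by `Π_X(M^Θ_*)`").
[claim: Mochizuki2012, status: disputed] (IUTchII §3 Prop 3.1 (i), kurims p.87) -/
theorem conj_permutes_both_record {M : Type} [CommMonoid M]
    (κ : M →* Multiplicative (thetaEnvData C hC hS hl hp2 hpl hζ mods f hf hmods h15 L hZ hcharY hlim).cohEnv.lim)
    {Iota : Type}
    (iota : Iota → ((thetaEnvData C hC hS hl hp2 hpl hζ mods f hf hmods h15 L hZ hcharY hlim).D.coh.lim ≃+
      (thetaEnvData C hC hS hl hp2 hpl hζ mods f hf hmods h15 L hZ hcharY hlim).D.coh.lim))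
    (hι : ∀ (g : Pi C) (ι : Iota), ∃ ι' : Iota, ∀ x,
      iota ι' (h1LimConjEquiv (phi C) (D.lDeltaTheta l) (PiYdd C) g x) =
        h1LimConjEquiv (phi C) (D.lDeltaTheta l) (PiYdd C) g (iota ι x))
    (hU : ∀ (g : Pi C) (x : ((thetaEnvData C hC hS hl hp2 hpl hζ mods f hf hmods h15 L hZ hcharY hlim).toRecord
        (h1LimConjMulAut (phi C) (D.lDeltaTheta l) (PiYdd C)) κ iota).H),
      x ∈ ((thetaEnvData C hC hS hl hp2 hpl hζ mods f hf hmods h15 L hZ hcharY hlim).toRecord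
          (h1LimConjMulAut (phi C) (D.lDeltaTheta l) (PiYdd C)) κ iota).units →
        ((thetaEnvData C hC hS hl hp2 hpl hζ mods f hf hmods h15 L hZ hcharY hlim).toRecord
          (h1LimConjMulAut (phi C) (D.lDeltaTheta l) (PiYdd C)) κ iota).conj g x ∈
          ((thetaEnvData C hC hS hl hp2 hpl hζ mods f hf hmods h15 L hZ hcharY hlim).toRecord
            (h1LimConjMulAut (phi C) (D.lDeltaTheta l) (PiYdd C)) κ iota).units)
    (g : Pi C) (ι : Iota) :
    ∃ ι' : Iota,
      (((thetaEnvData C hC hS hl hp2 hpl hζ mods f hf hmods h15 L hZ hcharY hlim).toRecord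
          (h1LimConjMulAut (phi C) (D.lDeltaTheta l) (PiYdd C)) κ iota).thetaMonoid ι).map
          (((thetaEnvData C hC hS hl hp2 hpl hζ mods f hf hmods h15 L hZ hcharY hlim).toRecord
            (h1LimConjMulAut (phi C) (D.lDeltaTheta l) (PiYdd C)) κ iota).conj g).toMonoidHom =
        ((thetaEnvData C hC hS hl hp2 hpl hζ mods f hf hmods h15 L hZ hcharY hlim).toRecord
          (h1LimConjMulAut (phi C) (D.lDeltaTheta l) (PiYdd C)) κ iota).thetaMonoid ι' ∧
      (((thetaEnvData C hC hS hl hp2 hpl hζ mods f hf hmods h15 L hZ hcharY hlim).toRecord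
          (h1LimConjMulAut (phi C) (D.lDeltaTheta l) (PiYdd C)) κ iota).inftyThetaMonoid ι).map
          (((thetaEnvData C hC hS hl hp2 hpl hζ mods f hf hmods h15 L hZ hcharY hlim).toRecord
            (h1LimConjMulAut (phi C) (D.lDeltaTheta l) (PiYdd C)) κ iota).conj g).toMonoidHom =
        ((thetaEnvData C hC hS hl hp2 hpl hζ mods f hf hmods h15 L hZ hcharY hlim).toRecord
          (h1LimConjMulAut (phi C) (D.lDeltaTheta l) (PiYdd C)) κ iota).inftyThetaMonoid ι' :=
  TemperedThetaMonoids.ThetaEnvData.conj_permutes_both_of_thetaEnvPermuted _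
    (thetaEnvPermuted_record C hC hS hl hp2 hpl hζ mods f hf hmods h15 L hZ hcharY hlim κ iota hι) hU g ι

end EtaleLevels

end Literature.IUT.HodgeArakelov
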